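import Mathlib
import HarnessLib
import Summits.HubbardSuperconductivity.HubbardSuperconductivity.Theorems.KLProgrammeKLRegimeSectorSliceDefectRateAlgebra

/-!
# Route `KLProgramme` — VL child `KLRegimeVolumeLimitV17F2` (stmt-HubbardSuperconductivity-20440), closer MODEL file M2 «MISMATCH-SLICE», brackets (a)(b),
# RATE FORM, part 1b: the closed amplitude of `…SectorSliceDefectRowsFat` at the canonical rates is `≤ Q·((2M+1)/β)·ε`, `Q` free of `(L, M, ε, K, K′)`

Cell `gate-hubbard-kl`, seat hubbard-kl-k3c4-p2 (g13; UV / Matsubara all-U lane); WANT (w7) of the VL registrant k3c4-p1 g12 (KL STATUS 2026-08-28 00:32Z).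
Part 1a (`…SectorSliceDefectRateAlgebra`) proved the abstract pieces; here they are packaged against the LITERAL defining equations of
`rowSum_/colSum_sliceCT_sub_bgmFat_le` (p580272) at `s₀ := 1/(2M)`, `s₁ = s₂ = s₃ = s₃′ := 1`, `Nr := 2`, `R₀ := 0`, `P₀ = … = P₃ := ε ∈ [0,1]`:

* §5 `rateBlock3_le`, `rateBlock2_le` (the four spatial rate blocks are `≤ ε·(βL²)⁻¹ ×` an `L`-free shape), `incrX_pack` (the increment polynomials),
  `incrTt_pack` (the time block), `rateAmps_pack` (the six direction amplitudes `L·Ae1 ≤ ae1`, `L²·Ae2 ≤ ae2`, …);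
* §6 **`sliceDefect_rate_core`** — `∃ Q ≥ 0` (depending on the fixed data and the eleven `rfl`-abbreviations `xp₀ … av2` only) with, for ALL `L ≥ 1`,
  `2M ≥ 1`, `ε ∈ [0,1]` and all reals satisfying those equations: `8·(9·(D·(√W·√(24·2M·L²·N̄_L)·A^Δ))) ≤ Q·((2M+1)/β)·ε` — the grid density `2M/β`
  of the space-time lattice is the only `M`-growth of plain covariance rows (as in every `alphaWt … ≤ Cα·(M/β)/Λ` of the tree), the entry sup is separate.
Proofs only; no definitions. [folklore] BGM 2006 §2.8 (2.81), §3 (3.3).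
-/

noncomputable section

namespace Summit.HubbardSuperconductivity.HubbardSuperconductivity.Theorems.TorusFourierL2

set_option linter.dupNamespace false -- summit = problem name (single-conjunct summit), D-0017

open scoped Real

/-! ## §5 Packaged ingredients -/

/-- The cubic rate block is `≤ ε × (1/C) ×` its `L`-free shape, given the increment bounds `X_i ≤ ε·(C·xp_i)` and `L·A₁ ≤ a₁`, `L²·A₂ ≤ a₂`. [folklore] -/
theorem rateBlock3_le {ℓ c L C ε X₀ X₁ X₂ X₃ A₁ A₂ a₁ a₂ κ Λm xp₀ xp₁ xp₂ xp₃ : ℝ} (hL : 0 < L) (hC : 0 < C) (hc : 0 ≤ c)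
    (hΛm : 0 < Λm) (hℓ : ℓ = c / L) (hA₁ : 0 ≤ A₁) (hA₂ : 0 ≤ A₂) (ha₁ : L * A₁ ≤ a₁) (ha₂ : L ^ 2 * A₂ ≤ a₂)
    (hX₁0 : 0 ≤ X₁) (hX₂0 : 0 ≤ X₂) (hX₀ : X₀ = ε * (C * xp₀)) (hX₁ : X₁ ≤ ε * (C * xp₁)) (hX₂ : X₂ ≤ ε * (C * xp₂)) (hX₃ : X₃ ≤ ε * (C * xp₃)) :
    (1 / C) ^ 2 * ((Real.sqrt 2 * ℓ) ^ 3 * X₃ + 3 * (A₁ * ((Real.sqrt 2 * ℓ) ^ 2 * X₂)) + 3 * (A₂ * ((Real.sqrt 2 * ℓ) * X₁)) + κ * ℓ ^ 3 / Λm ^ 3 * X₀) /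
        (4 / (1 * L)) ^ 3 ≤
      ε * (1 / C * (((Real.sqrt 2 * c) ^ 3 * xp₃ + 3 * (a₁ * ((Real.sqrt 2 * c) ^ 2 * xp₂)) + 3 * (a₂ * ((Real.sqrt 2 * c) * xp₁)) +
        κ * c ^ 3 / Λm ^ 3 * xp₀) / 64)) := by
  have ha₁0 : 0 ≤ a₁ := (mul_nonneg hL.le hA₁).trans ha₁
  have ha₂0 : 0 ≤ a₂ := (mul_nonneg (sq_nonneg _) hA₂).trans ha₂
  rw [mul_div_assoc, rateBlock3_eq hL.ne' one_ne_zero hΛm.ne' hℓ, hX₀]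
  calc (1 / C) ^ 2 * ((1 : ℝ) ^ 3 * ((Real.sqrt 2 * c) ^ 3 * X₃ + 3 * ((L * A₁) * ((Real.sqrt 2 * c) ^ 2 * X₂)) +
          3 * ((L ^ 2 * A₂) * ((Real.sqrt 2 * c) * X₁)) + κ * c ^ 3 / Λm ^ 3 * (ε * (C * xp₀))) / 64)
      ≤ (1 / C) ^ 2 * ((1 : ℝ) ^ 3 * ((Real.sqrt 2 * c) ^ 3 * (ε * (C * xp₃)) + 3 * (a₁ * ((Real.sqrt 2 * c) ^ 2 * (ε * (C * xp₂)))) +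
          3 * (a₂ * ((Real.sqrt 2 * c) * (ε * (C * xp₁)))) + κ * c ^ 3 / Λm ^ 3 * (ε * (C * xp₀))) / 64) := by gcongr
    _ = _ := by field_simp

/-- The quadratic rate block, likewise. [folklore] -/
theorem rateBlock2_le {ℓ c L C ε X₀ X₁ X₂ A₁ A₂ a₁ a₂ xp₀ xp₁ xp₂ : ℝ} (hL : 0 < L) (hC : 0 < C) (hε : 0 ≤ ε) (hc : 0 ≤ c)
    (hℓ : ℓ = c / L) (hA₁ : 0 ≤ A₁) (hA₂ : 0 ≤ A₂) (ha₁ : L * A₁ ≤ a₁) (ha₂ : L ^ 2 * A₂ ≤ a₂)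
    (hX₁0 : 0 ≤ X₁) (hxp₀ : 0 ≤ xp₀) (hX₀ : X₀ = ε * (C * xp₀)) (hX₁ : X₁ ≤ ε * (C * xp₁)) (hX₂ : X₂ ≤ ε * (C * xp₂)) :
    (1 / C) ^ 2 * ((Real.sqrt 2 * ℓ) ^ 2 * X₂ + 2 * (A₁ * ((Real.sqrt 2 * ℓ) * X₁)) + A₂ * X₀) / (4 / (1 * L)) ^ 2 ≤
      ε * (1 / C * (((Real.sqrt 2 * c) ^ 2 * xp₂ + 2 * (a₁ * ((Real.sqrt 2 * c) * xp₁)) + a₂ * xp₀) / 16)) := by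
  have ha₁0 : 0 ≤ a₁ := (mul_nonneg hL.le hA₁).trans ha₁
  have ha₂0 : 0 ≤ a₂ := (mul_nonneg (sq_nonneg _) hA₂).trans ha₂
  rw [mul_div_assoc, rateBlock2_eq hL.ne' one_ne_zero hℓ, hX₀]
  calc (1 / C) ^ 2 * ((1 : ℝ) ^ 2 * ((Real.sqrt 2 * c) ^ 2 * X₂ + 2 * ((L * A₁) * ((Real.sqrt 2 * c) * X₁)) + (L ^ 2 * A₂) * (ε * (C * xp₀))) / 16)
      ≤ (1 / C) ^ 2 * ((1 : ℝ) ^ 2 * ((Real.sqrt 2 * c) ^ 2 * (ε * (C * xp₂)) + 2 * (a₁ * ((Real.sqrt 2 * c) * (ε * (C * xp₁)))) +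
          a₂ * (ε * (C * xp₀))) / 16) := by gcongr
    _ = _ := by field_simp

/-- **The increment polynomials of p580272 at `P ≡ ε`**: `X₀ = ε·C·xp₀`, `X_i ≤ ε·C·xp_i` (`i = 1,2,3`), all nonnegative, `C = βL²`. [folklore] -/
theorem incrX_pack {Λ β Lr K₁ K₂ K₃ B₁ B₂ B₃ B₄ ε X₀ X₁ X₂ X₃ xp₀ xp₁ xp₂ xp₃ : ℝ} (hΛ : 0 < Λ) (hβ : 0 < β) (hL : 0 < Lr) (hε : 0 ≤ ε) (hε1 : ε ≤ 1)
    (hK₁ : 0 ≤ K₁) (hK₂ : 0 ≤ K₂) (hK₃ : 0 ≤ K₃) (hB₁ : 0 ≤ B₁) (hB₂ : 0 ≤ B₂) (hB₃ : 0 ≤ B₃) (hB₄ : 0 ≤ B₄)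
    (hxp₀ : xp₀ = (16 * B₁ + 16) / Λ ^ 2) (hxp₁ : xp₁ = (32 * B₂ + 144 * B₁ + 128) / Λ ^ 3 * (K₁ + 1) + (16 * B₁ + 16) / Λ ^ 2)
    (hxp₂ : xp₂ = (64 * B₃ + 480 * B₂ + 1728 * B₁ + 1536) / Λ ^ 4 * (K₁ + 1) ^ 2 + (32 * B₂ + 144 * B₁ + 128) / Λ ^ 3 * (2 * K₁ + 1) + ((32 * B₂ + 144 * B₁ + 128) / Λ ^ 3 * (K₂ + 1) + (16 * B₁ + 16) / Λ ^ 2))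
    (hxp₃ : xp₃ = (128 * B₄ + 1408 * B₃ + 7776 * B₂ + 27648 * B₁ + 24576) / Λ ^ 5 * (K₁ + 1) ^ 3 + (64 * B₃ + 480 * B₂ + 1728 * B₁ + 1536) / Λ ^ 4 * (3 * K₁ ^ 2 + 3 * K₁ + 1) + 3 * ((64 * B₃ + 480 * B₂ + 1728 * B₁ + 1536) / Λ ^ 4 * ((K₁ + 1) * (K₂ + 1)) + (32 * B₂ + 144 * B₁ + 128) / Λ ^ 3 * (K₁ + K₂ + 1)) + ((32 * B₂ + 144 * B₁ + 128) / Λ ^ 3 * (K₃ + 1) + (16 * B₁ + 16) / Λ ^ 2))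
    (hX₀ : X₀ = (16 * B₁ + 16) * (β * Lr ^ 2) / Λ ^ 2 * ε)
    (hX₁ : X₁ = (32 * B₂ + 144 * B₁ + 128) * (β * Lr ^ 2) / Λ ^ 3 * ε * (K₁ + ε) + (16 * B₁ + 16) * (β * Lr ^ 2) / Λ ^ 2 * ε)
    (hX₂ : X₂ = (64 * B₃ + 480 * B₂ + 1728 * B₁ + 1536) * (β * Lr ^ 2) / Λ ^ 4 * ε * (K₁ + ε) ^ 2 +
      (32 * B₂ + 144 * B₁ + 128) * (β * Lr ^ 2) / Λ ^ 3 * (ε * (2 * K₁ + ε)) +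
      ((32 * B₂ + 144 * B₁ + 128) * (β * Lr ^ 2) / Λ ^ 3 * ε * (K₂ + ε) + (16 * B₁ + 16) * (β * Lr ^ 2) / Λ ^ 2 * ε))
    (hX₃ : X₃ = (128 * B₄ + 1408 * B₃ + 7776 * B₂ + 27648 * B₁ + 24576) * (β * Lr ^ 2) / Λ ^ 5 * ε * (K₁ + ε) ^ 3 +
      (64 * B₃ + 480 * B₂ + 1728 * B₁ + 1536) * (β * Lr ^ 2) / Λ ^ 4 * (ε * (3 * K₁ ^ 2 + 3 * K₁ * ε + ε ^ 2)) +
      3 * ((64 * B₃ + 480 * B₂ + 1728 * B₁ + 1536) * (β * Lr ^ 2) / Λ ^ 4 * ε * ((K₁ + ε) * (K₂ + ε)) +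
        (32 * B₂ + 144 * B₁ + 128) * (β * Lr ^ 2) / Λ ^ 3 * (K₁ * ε + ε * K₂ + ε * ε)) +
      ((32 * B₂ + 144 * B₁ + 128) * (β * Lr ^ 2) / Λ ^ 3 * ε * (K₃ + ε) + (16 * B₁ + 16) * (β * Lr ^ 2) / Λ ^ 2 * ε)) :
    X₀ = ε * ((β * Lr ^ 2) * xp₀) ∧ X₁ ≤ ε * ((β * Lr ^ 2) * xp₁) ∧ X₂ ≤ ε * ((β * Lr ^ 2) * xp₂) ∧ X₃ ≤ ε * ((β * Lr ^ 2) * xp₃) ∧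
      0 ≤ X₀ ∧ 0 ≤ X₁ ∧ 0 ≤ X₂ ∧ 0 ≤ X₃ ∧ 0 ≤ xp₀ ∧ 0 ≤ xp₁ ∧ 0 ≤ xp₂ ∧ 0 ≤ xp₃ := by
  refine ⟨by rw [hX₀, hxp₀]; ring, (incrX₁_le (by positivity) hε hε1 hX₁).trans (le_of_eq (by rw [hxp₁]; ring)),
    (incrX₂_le (by positivity) (by positivity) hK₁ hε hε1 hX₂).trans (le_of_eq (by rw [hxp₂]; ring)),
    (incrX₃_le (by positivity) (by positivity) (by positivity) hK₁ hK₂ hε hε1 hX₃).trans (le_of_eq (by rw [hxp₃]; ring)),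
    by rw [hX₀]; positivity, by rw [hX₁]; positivity, by rw [hX₂]; positivity, by rw [hX₃]; positivity,
    by rw [hxp₀]; positivity, by rw [hxp₁]; positivity, by rw [hxp₂]; positivity, by rw [hxp₃]; positivity⟩

/-- **The time block of p580272 at `P₀ = ε`**: `Tt = ε·(1/C)·tt` with `tt` free of `(L, ε)`, and `0 ≤ Tt`. [folklore] -/
theorem incrTt_pack {Λ Λm β Lr G₁ G₂ G₃ B₁ B₂ B₃ B₄ ε Tt tt : ℝ} (hΛ : 0 < Λ) (hΛm : 0 < Λm) (hβ : 0 < β) (hL : 0 < Lr) (hε : 0 ≤ ε)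
    (hG₁ : 0 ≤ G₁) (hG₂ : 0 ≤ G₂) (hG₃ : 0 ≤ G₃) (hB₁ : 0 ≤ B₁) (hB₂ : 0 ≤ B₂) (hB₃ : 0 ≤ B₃) (hB₄ : 0 ≤ B₄)
    (htt : tt = 1 * ((2 * π / β) ^ 3 * ((128 * B₄ + 1216 * B₃ + 6912 * B₂ + 26112 * B₁ + 24576) / Λ ^ 5)) + 3 * ((2 * G₁ * |2 * π / β| * 1 / Λm) * ((2 * π / β) ^ 2 * ((64 * B₃ + 416 * B₂ + 1600 * B₁ + 1536) / Λ ^ 4))) + 3 * (((4 * G₂ + 2 * G₁) * (2 * π / β) ^ 2 * 1 / Λm ^ 2) * ((2 * π / β) * ((32 * B₂ + 128 * B₁ + 128) / Λ ^ 3))) + ((8 * G₃ + 12 * G₂) * |2 * π / β| ^ 3 * 1 / Λm ^ 3) * ((16 * B₁ + 16) / Λ ^ 2))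
    (hTt : Tt = (1 / (β * Lr ^ 2)) ^ 2 *
      (1 * ((2 * π / β) ^ 3 * ((128 * B₄ + 1216 * B₃ + 6912 * B₂ + 26112 * B₁ + 24576) * (β * Lr ^ 2) / Λ ^ 5 * ε)) +
        3 * ((2 * G₁ * |2 * π / β| * 1 / Λm) * ((2 * π / β) ^ 2 * ((64 * B₃ + 416 * B₂ + 1600 * B₁ + 1536) * (β * Lr ^ 2) / Λ ^ 4 * ε))) +
        3 * (((4 * G₂ + 2 * G₁) * (2 * π / β) ^ 2 * 1 / Λm ^ 2) * ((2 * π / β) * ((32 * B₂ + 128 * B₁ + 128) * (β * Lr ^ 2) / Λ ^ 3 * ε))) +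
        ((8 * G₃ + 12 * G₂) * |2 * π / β| ^ 3 * 1 / Λm ^ 3) * ((16 * B₁ + 16) * (β * Lr ^ 2) / Λ ^ 2 * ε))) :
    Tt = ε * (1 / (β * Lr ^ 2) * tt) ∧ 0 ≤ Tt ∧ 0 ≤ tt := by
  have htt0 : 0 ≤ tt := by rw [htt]; positivity
  have e : Tt = ε * (1 / (β * Lr ^ 2) * tt) := by rw [hTt, htt]; field_simp
  exact ⟨e, by rw [e]; positivity, htt0⟩

/-- **The six direction amplitudes of p580272 at `Nr = 2`**: `L·Ae1 ≤ ae1`, `L²·Ae2 ≤ ae2`, … with `ae1 … av2` free of `L`; all nonnegative. [folklore] -/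
theorem rateAmps_pack {Lr Λm A Ba Kp wsi ρf G₁ G₂ ℓ₁ ℓ Ae1 Ae2 An1 An2 Av1 Av2 ae1 ae2 an1 an2 av1 av2 : ℝ} (hL : 1 ≤ Lr) (hΛm : 0 < Λm)
    (hA : 0 ≤ A) (hBa : 0 ≤ Ba) (hKp : 0 ≤ Kp) (hwsi : 0 ≤ wsi) (hρf : 0 ≤ ρf) (hG₁ : 0 ≤ G₁) (hG₂ : 0 ≤ G₂)
    (hℓ₁ : ℓ₁ = 2 * π / Lr) (hℓ : ℓ = 2 * π / Lr * (2 + 1 / 2))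
    (hae1 : ae1 = 2 * G₁ * ((4 + 2 * A) * (2 * π) + Kp * (ρf + 4 * π) * (2 * π)) / Λm + 9 * (4 * Ba * ((1 + 2 * wsi) * (2 * (2 * π)))))
    (hae2 : ae2 = (4 * G₂ + 2 * G₁) * ((4 + 2 * A) * (2 * π) + Kp * (ρf + 4 * π) * (2 * π)) ^ 2 / Λm ^ 2 + 2 * G₁ * (Kp * (2 * π) ^ 2) / Λm + 4 * G₁ * ((4 + 2 * A) * (2 * π) + Kp * (ρf + 4 * π) * (2 * π)) / Λm * (9 * (4 * Ba * ((1 + 2 * wsi) * (2 * (2 * π))))) + (9 * (4 * Ba * ((1 + 2 * wsi) * (2 * (2 * π)))) ^ 2 + 8 * Ba ^ 2 * ((1 + 2 * wsi) * (2 * (2 * π))) ^ 2))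
    (han1 : an1 = 2 * G₁ * ((4 + 2 * A) * (5 * π) + Kp * (ρf + 10 * π) * (5 * π)) / Λm + 9 * (4 * Ba * ((1 + 2 * wsi) * (2 * (5 * π)))))
    (han2 : an2 = (4 * G₂ + 2 * G₁) * ((4 + 2 * A) * (5 * π) + Kp * (ρf + 10 * π) * (5 * π)) ^ 2 / Λm ^ 2 + 2 * G₁ * (Kp * (5 * π) ^ 2) / Λm + 4 * G₁ * ((4 + 2 * A) * (5 * π) + Kp * (ρf + 10 * π) * (5 * π)) / Λm * (9 * (4 * Ba * ((1 + 2 * wsi) * (2 * (5 * π))))) + (9 * (4 * Ba * ((1 + 2 * wsi) * (2 * (5 * π)))) ^ 2 + 8 * Ba ^ 2 * ((1 + 2 * wsi) * (2 * (5 * π))) ^ 2))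
    (hav1 : av1 = 2 * G₁ * ((2 * π) * (4 + 2 * A) + Kp * (ρf + 10 * π) * (5 * π)) / Λm + 9 * (4 * Ba * ((1 + 2 * wsi) * (2 * (5 * π)))))
    (hav2 : av2 = (4 * G₂ + 2 * G₁) * ((2 * π) * (4 + 2 * A) + Kp * (ρf + 10 * π) * (5 * π)) ^ 2 / Λm ^ 2 + 2 * G₁ * (Kp * (5 * π) ^ 2) / Λm + 4 * G₁ * ((2 * π) * (4 + 2 * A) + Kp * (ρf + 10 * π) * (5 * π)) / Λm * (9 * (4 * Ba * ((1 + 2 * wsi) * (2 * (5 * π))))) + (9 * (4 * Ba * ((1 + 2 * wsi) * (2 * (5 * π)))) ^ 2 + 8 * Ba ^ 2 * ((1 + 2 * wsi) * (2 * (5 * π))) ^ 2))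
    (hAe1 : Ae1 = 2 * G₁ * ((4 + 2 * A) * ℓ₁ + Kp * (ρf + 2 * ℓ₁) * ℓ₁) / Λm * 1 + 1 * 1 * (9 * (4 * Ba * ((1 + 2 * wsi) * (2 * ℓ₁)))))
    (hAe2 : Ae2 = ((4 * G₂ + 2 * G₁) * ((4 + 2 * A) * ℓ₁ + Kp * (ρf + 2 * ℓ₁) * ℓ₁) ^ 2 / Λm ^ 2 + 2 * G₁ * (Kp * ℓ₁ ^ 2) / Λm) * 1 +
      4 * G₁ * ((4 + 2 * A) * ℓ₁ + Kp * (ρf + 2 * ℓ₁) * ℓ₁) / Λm * (9 * (4 * Ba * ((1 + 2 * wsi) * (2 * ℓ₁)))) +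
      1 * 1 * (9 * (4 * Ba * ((1 + 2 * wsi) * (2 * ℓ₁))) ^ 2 + 8 * Ba ^ 2 * ((1 + 2 * wsi) * (2 * ℓ₁)) ^ 2))
    (hAn1 : An1 = 2 * G₁ * ((4 + 2 * A) * ℓ + Kp * (ρf + 2 * ℓ) * ℓ) / Λm * 1 + 1 * 1 * (9 * (4 * Ba * ((1 + 2 * wsi) * (2 * ℓ)))))
    (hAn2 : An2 = ((4 * G₂ + 2 * G₁) * ((4 + 2 * A) * ℓ + Kp * (ρf + 2 * ℓ) * ℓ) ^ 2 / Λm ^ 2 + 2 * G₁ * (Kp * ℓ ^ 2) / Λm) * 1 +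
      4 * G₁ * ((4 + 2 * A) * ℓ + Kp * (ρf + 2 * ℓ) * ℓ) / Λm * (9 * (4 * Ba * ((1 + 2 * wsi) * (2 * ℓ)))) +
      1 * 1 * (9 * (4 * Ba * ((1 + 2 * wsi) * (2 * ℓ))) ^ 2 + 8 * Ba ^ 2 * ((1 + 2 * wsi) * (2 * ℓ)) ^ 2))
    (hAv1 : Av1 = 2 * G₁ * (|2 * π / Lr| * (4 + 2 * A) + Kp * (ρf + 2 * ℓ) * ℓ) / Λm * 1 + 1 * 1 * (9 * (4 * Ba * ((1 + 2 * wsi) * (2 * ℓ)))))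
    (hAv2 : Av2 = ((4 * G₂ + 2 * G₁) * (|2 * π / Lr| * (4 + 2 * A) + Kp * (ρf + 2 * ℓ) * ℓ) ^ 2 / Λm ^ 2 + 2 * G₁ * (Kp * ℓ ^ 2) / Λm) * 1 +
      4 * G₁ * (|2 * π / Lr| * (4 + 2 * A) + Kp * (ρf + 2 * ℓ) * ℓ) / Λm * (9 * (4 * Ba * ((1 + 2 * wsi) * (2 * ℓ)))) +
      1 * 1 * (9 * (4 * Ba * ((1 + 2 * wsi) * (2 * ℓ))) ^ 2 + 8 * Ba ^ 2 * ((1 + 2 * wsi) * (2 * ℓ)) ^ 2)) :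
    Lr * Ae1 ≤ ae1 ∧ Lr ^ 2 * Ae2 ≤ ae2 ∧ Lr * An1 ≤ an1 ∧ Lr ^ 2 * An2 ≤ an2 ∧ Lr * Av1 ≤ av1 ∧ Lr ^ 2 * Av2 ≤ av2 ∧
      0 ≤ Ae1 ∧ 0 ≤ Ae2 ∧ 0 ≤ An1 ∧ 0 ≤ An2 ∧ 0 ≤ Av1 ∧ 0 ≤ Av2 ∧ 0 ≤ ℓ₁ ∧ 0 ≤ ℓ := by
  have hL0 : 0 < Lr := lt_of_lt_of_le one_pos hL
  obtain ⟨hLℓ₁, hLℓ, hℓ₁0, hℓ0, hue, hun, huv, hue0, hun0, huv0⟩ := rateDir_mul_le (Kp := Kp) (ρf := ρf) hL hA hKp hρf hℓ₁ hℓ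
  refine ⟨?_, ?_, ?_, ?_, ?_, ?_, by rw [hAe1]; positivity, by rw [hAe2]; positivity, by rw [hAn1]; positivity, by rw [hAn2]; positivity,
    by rw [hAv1]; positivity, by rw [hAv2]; positivity, hℓ₁0, hℓ0⟩
  · rw [hae1]; exact rateAmp1_mul_le hG₁ hΛm hBa hwsi hue hLℓ₁ hAe1
  · rw [hae2]; exact rateAmp2_mul_le hL0.le hG₁ hG₂ hΛm hBa hwsi hKp hue0 hℓ₁0 hue hLℓ₁ hAe2
  · rw [han1]; exact rateAmp1_mul_le hG₁ hΛm hBa hwsi hun hLℓ hAn1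
  · rw [han2]; exact rateAmp2_mul_le hL0.le hG₁ hG₂ hΛm hBa hwsi hKp hun0 hℓ0 hun hLℓ hAn2
  · rw [hav1]; exact rateAmp1_mul_le hG₁ hΛm hBa hwsi huv hLℓ hAv1
  · rw [hav2]; exact rateAmp2_mul_le hL0.le hG₁ hG₂ hΛm hBa hwsi hKp huv0 hℓ0 huv hLℓ hAv2

/-! ## §6 The rate core -/

set_option maxHeartbeats 400000 in -- 45 hypotheses carrying closed amplitudes: the context scans need ≈ 1.5× the default budget
/-- **RATE CORE of brackets (a)(b).**  For fixed data `(Λm, Λ, β, A, Ba, Kp, wsi, ρf, rm, G₁, G₂, G₃, κ₃F, K₁, K₂, K₃, B₁…B₄, D)` and the eleven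
`(L, M, ε)`-free abbreviations `xp₀ … xp₃, tt, ae1 … av2` (instantiate with `rfl`) there is `Q ≥ 0` such that for every `L ≥ 1`, `2M ≥ 1`, `ε ∈ [0,1]`
and all reals satisfying the defining equations of `…SectorSliceDefectRowsFat` at the canonical rates (`s₀ = 1/(2M)`, `s₁ = s₂ = s₃ = s₃′ = 1`, `Nr = 2`,
`R₀ = 0`, `P ≡ ε`), its row / column / entry bound is `≤ Q·((2M+1)/β)·ε`. [folklore] -/
theorem sliceDefect_rate_core (Λm Λ β A Ba Kp wsi ρf rm G₁ G₂ G₃ κ₃F K₁ K₂ K₃ B₁ B₂ B₃ B₄ D : ℝ)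
    {xp₀ xp₁ xp₂ xp₃ tt ae1 ae2 an1 an2 av1 av2 : ℝ}
    (hxp₀ : xp₀ = (16 * B₁ + 16) / Λ ^ 2) (hxp₁ : xp₁ = (32 * B₂ + 144 * B₁ + 128) / Λ ^ 3 * (K₁ + 1) + (16 * B₁ + 16) / Λ ^ 2)
    (hxp₂ : xp₂ = (64 * B₃ + 480 * B₂ + 1728 * B₁ + 1536) / Λ ^ 4 * (K₁ + 1) ^ 2 + (32 * B₂ + 144 * B₁ + 128) / Λ ^ 3 * (2 * K₁ + 1) + ((32 * B₂ + 144 * B₁ + 128) / Λ ^ 3 * (K₂ + 1) + (16 * B₁ + 16) / Λ ^ 2))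
    (hxp₃ : xp₃ = (128 * B₄ + 1408 * B₃ + 7776 * B₂ + 27648 * B₁ + 24576) / Λ ^ 5 * (K₁ + 1) ^ 3 + (64 * B₃ + 480 * B₂ + 1728 * B₁ + 1536) / Λ ^ 4 * (3 * K₁ ^ 2 + 3 * K₁ + 1) + 3 * ((64 * B₃ + 480 * B₂ + 1728 * B₁ + 1536) / Λ ^ 4 * ((K₁ + 1) * (K₂ + 1)) + (32 * B₂ + 144 * B₁ + 128) / Λ ^ 3 * (K₁ + K₂ + 1)) + ((32 * B₂ + 144 * B₁ + 128) / Λ ^ 3 * (K₃ + 1) + (16 * B₁ + 16) / Λ ^ 2))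
    (htt : tt = 1 * ((2 * π / β) ^ 3 * ((128 * B₄ + 1216 * B₃ + 6912 * B₂ + 26112 * B₁ + 24576) / Λ ^ 5)) + 3 * ((2 * G₁ * |2 * π / β| * 1 / Λm) * ((2 * π / β) ^ 2 * ((64 * B₃ + 416 * B₂ + 1600 * B₁ + 1536) / Λ ^ 4))) + 3 * (((4 * G₂ + 2 * G₁) * (2 * π / β) ^ 2 * 1 / Λm ^ 2) * ((2 * π / β) * ((32 * B₂ + 128 * B₁ + 128) / Λ ^ 3))) + ((8 * G₃ + 12 * G₂) * |2 * π / β| ^ 3 * 1 / Λm ^ 3) * ((16 * B₁ + 16) / Λ ^ 2))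
    (hae1 : ae1 = 2 * G₁ * ((4 + 2 * A) * (2 * π) + Kp * (ρf + 4 * π) * (2 * π)) / Λm + 9 * (4 * Ba * ((1 + 2 * wsi) * (2 * (2 * π)))))
    (hae2 : ae2 = (4 * G₂ + 2 * G₁) * ((4 + 2 * A) * (2 * π) + Kp * (ρf + 4 * π) * (2 * π)) ^ 2 / Λm ^ 2 + 2 * G₁ * (Kp * (2 * π) ^ 2) / Λm + 4 * G₁ * ((4 + 2 * A) * (2 * π) + Kp * (ρf + 4 * π) * (2 * π)) / Λm * (9 * (4 * Ba * ((1 + 2 * wsi) * (2 * (2 * π))))) + (9 * (4 * Ba * ((1 + 2 * wsi) * (2 * (2 * π)))) ^ 2 + 8 * Ba ^ 2 * ((1 + 2 * wsi) * (2 * (2 * π))) ^ 2))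
    (han1 : an1 = 2 * G₁ * ((4 + 2 * A) * (5 * π) + Kp * (ρf + 10 * π) * (5 * π)) / Λm + 9 * (4 * Ba * ((1 + 2 * wsi) * (2 * (5 * π)))))
    (han2 : an2 = (4 * G₂ + 2 * G₁) * ((4 + 2 * A) * (5 * π) + Kp * (ρf + 10 * π) * (5 * π)) ^ 2 / Λm ^ 2 + 2 * G₁ * (Kp * (5 * π) ^ 2) / Λm + 4 * G₁ * ((4 + 2 * A) * (5 * π) + Kp * (ρf + 10 * π) * (5 * π)) / Λm * (9 * (4 * Ba * ((1 + 2 * wsi) * (2 * (5 * π))))) + (9 * (4 * Ba * ((1 + 2 * wsi) * (2 * (5 * π)))) ^ 2 + 8 * Ba ^ 2 * ((1 + 2 * wsi) * (2 * (5 * π))) ^ 2))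
    (hav1 : av1 = 2 * G₁ * ((2 * π) * (4 + 2 * A) + Kp * (ρf + 10 * π) * (5 * π)) / Λm + 9 * (4 * Ba * ((1 + 2 * wsi) * (2 * (5 * π)))))
    (hav2 : av2 = (4 * G₂ + 2 * G₁) * ((2 * π) * (4 + 2 * A) + Kp * (ρf + 10 * π) * (5 * π)) ^ 2 / Λm ^ 2 + 2 * G₁ * (Kp * (5 * π) ^ 2) / Λm + 4 * G₁ * ((2 * π) * (4 + 2 * A) + Kp * (ρf + 10 * π) * (5 * π)) / Λm * (9 * (4 * Ba * ((1 + 2 * wsi) * (2 * (5 * π))))) + (9 * (4 * Ba * ((1 + 2 * wsi) * (2 * (5 * π)))) ^ 2 + 8 * Ba ^ 2 * ((1 + 2 * wsi) * (2 * (5 * π))) ^ 2)) :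
    ∃ Q : ℝ, 0 ≤ Q ∧ ∀ (Lr M₂ ε ℓ₁ ℓ Ae1 Ae2 An1 An2 Av1 Av2 X₀ X₁ X₂ X₃ Tt AΔ : ℝ),
      1 ≤ Lr → 1 ≤ M₂ → 0 ≤ ε → ε ≤ 1 → 0 < Λm → 0 < Λ → 0 < β → 0 ≤ A → 0 ≤ Ba → 0 ≤ Kp → 0 ≤ wsi → 0 ≤ ρf → 0 < 2 * rm - 4 * A →
      0 ≤ G₁ → 0 ≤ G₂ → 0 ≤ G₃ → 0 ≤ κ₃F → 0 ≤ K₁ → 0 ≤ K₂ → 0 ≤ K₃ → 0 ≤ B₁ → 0 ≤ B₂ → 0 ≤ B₃ → 0 ≤ B₄ → 0 ≤ D →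
      ℓ₁ = 2 * π / Lr → ℓ = 2 * π / Lr * (2 + 1 / 2) →
      Ae1 = 2 * G₁ * ((4 + 2 * A) * ℓ₁ + Kp * (ρf + 2 * ℓ₁) * ℓ₁) / Λm * 1 + 1 * 1 * (9 * (4 * Ba * ((1 + 2 * wsi) * (2 * ℓ₁)))) →
      Ae2 = ((4 * G₂ + 2 * G₁) * ((4 + 2 * A) * ℓ₁ + Kp * (ρf + 2 * ℓ₁) * ℓ₁) ^ 2 / Λm ^ 2 + 2 * G₁ * (Kp * ℓ₁ ^ 2) / Λm) * 1 +
      4 * G₁ * ((4 + 2 * A) * ℓ₁ + Kp * (ρf + 2 * ℓ₁) * ℓ₁) / Λm * (9 * (4 * Ba * ((1 + 2 * wsi) * (2 * ℓ₁)))) +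
      1 * 1 * (9 * (4 * Ba * ((1 + 2 * wsi) * (2 * ℓ₁))) ^ 2 + 8 * Ba ^ 2 * ((1 + 2 * wsi) * (2 * ℓ₁)) ^ 2) →
      An1 = 2 * G₁ * ((4 + 2 * A) * ℓ + Kp * (ρf + 2 * ℓ) * ℓ) / Λm * 1 + 1 * 1 * (9 * (4 * Ba * ((1 + 2 * wsi) * (2 * ℓ)))) →
      An2 = ((4 * G₂ + 2 * G₁) * ((4 + 2 * A) * ℓ + Kp * (ρf + 2 * ℓ) * ℓ) ^ 2 / Λm ^ 2 + 2 * G₁ * (Kp * ℓ ^ 2) / Λm) * 1 +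
      4 * G₁ * ((4 + 2 * A) * ℓ + Kp * (ρf + 2 * ℓ) * ℓ) / Λm * (9 * (4 * Ba * ((1 + 2 * wsi) * (2 * ℓ)))) +
      1 * 1 * (9 * (4 * Ba * ((1 + 2 * wsi) * (2 * ℓ))) ^ 2 + 8 * Ba ^ 2 * ((1 + 2 * wsi) * (2 * ℓ)) ^ 2) →
      Av1 = 2 * G₁ * (|2 * π / Lr| * (4 + 2 * A) + Kp * (ρf + 2 * ℓ) * ℓ) / Λm * 1 + 1 * 1 * (9 * (4 * Ba * ((1 + 2 * wsi) * (2 * ℓ)))) →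
      Av2 = ((4 * G₂ + 2 * G₁) * (|2 * π / Lr| * (4 + 2 * A) + Kp * (ρf + 2 * ℓ) * ℓ) ^ 2 / Λm ^ 2 + 2 * G₁ * (Kp * ℓ ^ 2) / Λm) * 1 +
      4 * G₁ * (|2 * π / Lr| * (4 + 2 * A) + Kp * (ρf + 2 * ℓ) * ℓ) / Λm * (9 * (4 * Ba * ((1 + 2 * wsi) * (2 * ℓ)))) +
      1 * 1 * (9 * (4 * Ba * ((1 + 2 * wsi) * (2 * ℓ))) ^ 2 + 8 * Ba ^ 2 * ((1 + 2 * wsi) * (2 * ℓ)) ^ 2) →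
      X₀ = (16 * B₁ + 16) * (β * Lr ^ 2) / Λ ^ 2 * ε →
      X₁ = (32 * B₂ + 144 * B₁ + 128) * (β * Lr ^ 2) / Λ ^ 3 * ε * (K₁ + ε) + (16 * B₁ + 16) * (β * Lr ^ 2) / Λ ^ 2 * ε →
      X₂ = (64 * B₃ + 480 * B₂ + 1728 * B₁ + 1536) * (β * Lr ^ 2) / Λ ^ 4 * ε * (K₁ + ε) ^ 2 +
      (32 * B₂ + 144 * B₁ + 128) * (β * Lr ^ 2) / Λ ^ 3 * (ε * (2 * K₁ + ε)) +
      ((32 * B₂ + 144 * B₁ + 128) * (β * Lr ^ 2) / Λ ^ 3 * ε * (K₂ + ε) + (16 * B₁ + 16) * (β * Lr ^ 2) / Λ ^ 2 * ε) →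
      X₃ = (128 * B₄ + 1408 * B₃ + 7776 * B₂ + 27648 * B₁ + 24576) * (β * Lr ^ 2) / Λ ^ 5 * ε * (K₁ + ε) ^ 3 +
      (64 * B₃ + 480 * B₂ + 1728 * B₁ + 1536) * (β * Lr ^ 2) / Λ ^ 4 * (ε * (3 * K₁ ^ 2 + 3 * K₁ * ε + ε ^ 2)) +
      3 * ((64 * B₃ + 480 * B₂ + 1728 * B₁ + 1536) * (β * Lr ^ 2) / Λ ^ 4 * ε * ((K₁ + ε) * (K₂ + ε)) +
        (32 * B₂ + 144 * B₁ + 128) * (β * Lr ^ 2) / Λ ^ 3 * (K₁ * ε + ε * K₂ + ε * ε)) +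
      ((32 * B₂ + 144 * B₁ + 128) * (β * Lr ^ 2) / Λ ^ 3 * ε * (K₃ + ε) + (16 * B₁ + 16) * (β * Lr ^ 2) / Λ ^ 2 * ε) →
      Tt = (1 / (β * Lr ^ 2)) ^ 2 *
      (1 * ((2 * π / β) ^ 3 * ((128 * B₄ + 1216 * B₃ + 6912 * B₂ + 26112 * B₁ + 24576) * (β * Lr ^ 2) / Λ ^ 5 * ε)) +
        3 * ((2 * G₁ * |2 * π / β| * 1 / Λm) * ((2 * π / β) ^ 2 * ((64 * B₃ + 416 * B₂ + 1600 * B₁ + 1536) * (β * Lr ^ 2) / Λ ^ 4 * ε))) +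
        3 * (((4 * G₂ + 2 * G₁) * (2 * π / β) ^ 2 * 1 / Λm ^ 2) * ((2 * π / β) * ((32 * B₂ + 128 * B₁ + 128) * (β * Lr ^ 2) / Λ ^ 3 * ε))) +
        ((8 * G₃ + 12 * G₂) * |2 * π / β| ^ 3 * 1 / Λm ^ 3) * ((16 * B₁ + 16) * (β * Lr ^ 2) / Λ ^ 2 * ε)) →
      AΔ = (1 / (β * Lr ^ 2)) ^ 2 * X₀ + Tt / (4 / ((1 / M₂) * M₂)) ^ 3 +
        (1 / (β * Lr ^ 2)) ^ 2 * ((Real.sqrt 2 * ℓ₁) ^ 3 * X₃ + 3 * (Ae1 * ((Real.sqrt 2 * ℓ₁) ^ 2 * X₂)) +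
          3 * (Ae2 * ((Real.sqrt 2 * ℓ₁) * X₁)) + κ₃F * ℓ₁ ^ 3 / Λm ^ 3 * X₀) / (4 / (1 * Lr)) ^ 3 +
        (1 / (β * Lr ^ 2)) ^ 2 * ((Real.sqrt 2 * ℓ) ^ 3 * X₃ + 3 * (An1 * ((Real.sqrt 2 * ℓ) ^ 2 * X₂)) +
          3 * (An2 * ((Real.sqrt 2 * ℓ) * X₁)) + κ₃F * ℓ ^ 3 / Λm ^ 3 * X₀) / (4 / (1 * Lr)) ^ 3 +
        (1 / (β * Lr ^ 2)) ^ 2 * ((Real.sqrt 2 * ℓ) ^ 2 * X₂ + 2 * (Av1 * ((Real.sqrt 2 * ℓ) * X₁)) + Av2 * X₀) / (4 / (1 * Lr)) ^ 2 +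
        (1 / (β * Lr ^ 2)) ^ 2 * ((Real.sqrt 2 * ℓ) ^ 3 * X₃ + 3 * (Av1 * ((Real.sqrt 2 * ℓ) ^ 2 * X₂)) +
          3 * (Av2 * ((Real.sqrt 2 * ℓ) * X₁)) + κ₃F * ℓ ^ 3 / Λm ^ 3 * X₀) / (4 / (1 * Lr)) ^ 3 →
      8 * ((9 : ℕ) * (D * (Real.sqrt (524288 * (1 / (1 / M₂) + 1) *
          ((1 + 2 * Real.sqrt 2 * 1 / (1 * (2 - 1)) + 2 * Real.sqrt 2 * 1 / (1 * (2 - 1))) ^ 2 *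
            ((2 * Real.sqrt 2 / (1 * (2 - 1)) + 2) * (2 * Real.sqrt 2 / (1 * (2 - 1)) + 2))
            + (1 / 1 + 1) ^ 2 / (1 + 1 * ((0 : ℕ) : ℝ)))) *
        Real.sqrt (24 * M₂ * Lr ^ 2 * ((Λm * β / π + 1) * ((Real.sqrt 2 * Lr * ((Λm + (4 + 4 * A) * ρf ^ 2) / (2 * rm - 4 * A)) / π + 2) * (Real.sqrt 2 * Lr * (2 * ρf) / π + 2)))) * AΔ))) ≤
        Q * ((M₂ + 1) / β) * ε := by
  refine ⟨|8 * (9 * (D * (Real.sqrt (24 * (524288 * ((1 + 4 * Real.sqrt 2) ^ 2 * (2 * Real.sqrt 2 + 2) ^ 2 + 4)) * ((Λm * β / π + 1) * ((Real.sqrt 2 * ((Λm + (4 + 4 * A) * ρf ^ 2) / (2 * rm - 4 * A)) / π + 2) * (Real.sqrt 2 * (2 * ρf) / π + 2)))) * (xp₀ + tt / 64 + ((Real.sqrt 2 * (2 * π)) ^ 3 * xp₃ + 3 * (ae1 * ((Real.sqrt 2 * (2 * π)) ^ 2 * xp₂)) + 3 * (ae2 * ((Real.sqrt 2 * (2 *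 π)) * xp₁)) + κ₃F * (2 * π) ^ 3 / Λm ^ 3 * xp₀) / 64 + ((Real.sqrt 2 * (5 * π)) ^ 3 * xp₃ + 3 * (an1 * ((Real.sqrt 2 * (5 * π)) ^ 2 * xp₂)) + 3 * (an2 * ((Real.sqrt 2 * (5 * π)) * xp₁)) + κ₃F * (5 * π) ^ 3 / Λm ^ 3 * xp₀) / 64 + ((Real.sqrt 2 * (5 * π)) ^ 2 * xp₂ + 2 * (av1 * ((Real.sqrt 2 * (5 * π)) * xp₁)) + av2 * xp₀) / 16 + ((Real.sqrt 2 * (5 * π)) ^ 3 * xp₃ + 3 * (av1 * ((Real.sqrt 2 * (5 * π)) ^ 2 * xp₂)) + 3 * (av2 * ((Real.sqrt 2 * (5 * π)) * xp₁)) + κ₃F * (5 * π) ^ 3 / Λm ^ 3 * xp₀) / 64))))|, abs_nonneg _, ?_⟩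
  intro Lr M₂ ε ℓ₁ ℓ Ae1 Ae2 An1 An2 Av1 Av2 X₀ X₁ X₂ X₃ Tt AΔ hL1 hM1 hε0 hε1 hΛm hΛ hβ hA hBa hKp hwsi hρf hrm hG₁ hG₂ hG₃ hκ₃F hK₁ hK₂ hK₃
    hB₁ hB₂ hB₃ hB₄ hD hℓ₁ hℓ hAe1 hAe2 hAn1 hAn2 hAv1 hAv2 hX₀ hX₁ hX₂ hX₃ hTt hAΔ
  have hL0 : 0 < Lr := lt_of_lt_of_le one_pos hL1
  have hM0 : 0 < M₂ := lt_of_lt_of_le one_pos hM1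
  have hπ := Real.pi_pos
  have hC : 0 < β * Lr ^ 2 := by positivity
  obtain ⟨hX₀', hX₁', hX₂', hX₃', hX₀0, hX₁0, hX₂0, hX₃0, hxp₀0, hxp₁0, hxp₂0, hxp₃0⟩ :=
    incrX_pack hΛ hβ hL0 hε0 hε1 hK₁ hK₂ hK₃ hB₁ hB₂ hB₃ hB₄ hxp₀ hxp₁ hxp₂ hxp₃ hX₀ hX₁ hX₂ hX₃
  obtain ⟨hTt', hTt0, htt0⟩ := incrTt_pack hΛ hΛm hβ hL0 hε0 hG₁ hG₂ hG₃ hB₁ hB₂ hB₃ hB₄ htt hTt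
  obtain ⟨hae1', hae2', han1', han2', hav1', hav2', hAe10, hAe20, hAn10, hAn20, hAv10, hAv20, hℓ₁0, hℓ0⟩ :=
    rateAmps_pack hL1 hΛm hA hBa hKp hwsi hρf hG₁ hG₂ hℓ₁ hℓ hae1 hae2 han1 han2 hav1 hav2 hAe1 hAe2 hAn1 hAn2 hAv1 hAv2
  have hae10 : 0 ≤ ae1 := (mul_nonneg hL0.le hAe10).trans hae1'
  have hae20 : 0 ≤ ae2 := (mul_nonneg (sq_nonneg _) hAe20).trans hae2'
  have han10 : 0 ≤ an1 := (mul_nonneg hL0.le hAn10).trans han1'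
  have han20 : 0 ≤ an2 := (mul_nonneg (sq_nonneg _) hAn20).trans han2'
  have hav10 : 0 ≤ av1 := (mul_nonneg hL0.le hAv10).trans hav1'
  have hav20 : 0 ≤ av2 := (mul_nonneg (sq_nonneg _) hAv20).trans hav2'
  clear hX₁ hX₂ hX₃ hTt hAe1 hAe2 hAn1 hAn2 hAv1 hAv2 hxp₀ hxp₁ hxp₂ hxp₃ htt hae1 hae2 han1 han2 hav1 hav2
  -- the four spatial blocks, the two first terms, the amplitude
  have hℓ' : ℓ = (5 * π) / Lr := by rw [hℓ]; ring
  have hbe := rateBlock3_le (κ := κ₃F) hL0 hC (by positivity : (0:ℝ) ≤ 2 * π) hΛm hℓ₁ hAe10 hAe20 hae1' hae2' hX₁0 hX₂0 hX₀' hX₁' hX₂' hX₃'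
  have hbn := rateBlock3_le (κ := κ₃F) hL0 hC (by positivity : (0:ℝ) ≤ 5 * π) hΛm hℓ' hAn10 hAn20 han1' han2' hX₁0 hX₂0 hX₀' hX₁' hX₂' hX₃'
  have hbv3 := rateBlock3_le (κ := κ₃F) hL0 hC (by positivity : (0:ℝ) ≤ 5 * π) hΛm hℓ' hAv10 hAv20 hav1' hav2' hX₁0 hX₂0 hX₀' hX₁' hX₂' hX₃'
  have hbv2 := rateBlock2_le hL0 hC hε0 (by positivity : (0:ℝ) ≤ 5 * π) hℓ' hAv10 hAv20 hav1' hav2' hX₁0 hxp₀0 hX₀' hX₁' hX₂'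
  have h0 : (1 / (β * Lr ^ 2)) ^ 2 * X₀ = ε * (1 / (β * Lr ^ 2) * xp₀) := by rw [hX₀']; field_simp
  have hsM : 1 / M₂ * M₂ = 1 := by rw [one_div, inv_mul_cancel₀ hM0.ne']
  have h1 : Tt / (4 / ((1 / M₂) * M₂)) ^ 3 = ε * (1 / (β * Lr ^ 2) * (tt / 64)) := by rw [hsM, hTt']; ring
  have hAΔ' : AΔ ≤ ε * (1 / (β * Lr ^ 2) * (xp₀ + tt / 64 + ((Real.sqrt 2 * (2 * π)) ^ 3 * xp₃ + 3 * (ae1 * ((Real.sqrt 2 * (2 * π)) ^ 2 * xp₂)) + 3 * (ae2 * ((Real.sqrt 2 * (2 * π)) * xp₁)) + κ₃F * (2 * π) ^ 3 / Λm ^ 3 * xp₀) / 64 + ((Real.sqrt 2 * (5 * π)) ^ 3 * xp₃ + 3 * (an1 * ((Real.sqrt 2 * (5 * π)) ^ 2 * xp₂)) + 3 * (an2 * ((Real.sqrt 2 * (5 * π)) * xp₁)) + κ₃F * (5 * π) ^ 3 / Λm ^ 3 * xp₀) / 64 + ((Real.sqrt 2 * (5 * π)) ^ 2 * xp₂ +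 2 * (av1 * ((Real.sqrt 2 * (5 * π)) * xp₁)) + av2 * xp₀) / 16 + ((Real.sqrt 2 * (5 * π)) ^ 3 * xp₃ + 3 * (av1 * ((Real.sqrt 2 * (5 * π)) ^ 2 * xp₂)) + 3 * (av2 * ((Real.sqrt 2 * (5 * π)) * xp₁)) + κ₃F * (5 * π) ^ 3 / Λm ^ 3 * xp₀) / 64)) := by
    rw [hAΔ]
    linarith only [hbe, hbn, hbv3, hbv2, h0.le, h1.le]
  have hAΔ0 : 0 ≤ AΔ := by rw [hAΔ]; positivity
  clear hAΔ hbe hbn hbv3 hbv2 h0 h1 hTt' hX₀' hX₁' hX₂' hX₃' hae1' hae2' han1' han2' hav1' hav2' hX₀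
  -- the counting factor and the assembly
  have hr₁ : 0 ≤ (Λm + (4 + 4 * A) * ρf ^ 2) / (2 * rm - 4 * A) := div_nonneg (by positivity) hrm.le
  have hcnt := sliceDefect_count_le (r₁ := (Λm + (4 + 4 * A) * ρf ^ 2) / (2 * rm - 4 * A)) (r₂ := 2 * ρf) hL1 hM1 hΛm.le hβ.le hr₁
    (by positivity)
  set Am := (xp₀ + tt / 64 + ((Real.sqrt 2 * (2 * π)) ^ 3 * xp₃ + 3 * (ae1 * ((Real.sqrt 2 * (2 * π)) ^ 2 * xp₂)) + 3 * (ae2 * ((Real.sqrt 2 * (2 * π)) * xp₁)) + κ₃F * (2 * π) ^ 3 / Λm ^ 3 * xp₀) / 64 + ((Real.sqrt 2 * (5 * π)) ^ 3 * xp₃ + 3 * (an1 * ((Real.sqrt 2 * (5 * π)) ^ 2 * xp₂)) + 3 * (an2 * ((Real.sqrt 2 * (5 * π)) * xp₁)) + κ₃F * (5 * π) ^ 3 / Λm ^ 3 * xp₀) / 64 + ((Real.sqrt 2 * (5 * π)) ^ 2 * xp₂ + 2 * (av1 * ((Real.sqrt 2 * (5 * π)) * xp₁)) + av2 * xp₀)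 / 16 + ((Real.sqrt 2 * (5 * π)) ^ 3 * xp₃ + 3 * (av1 * ((Real.sqrt 2 * (5 * π)) ^ 2 * xp₂)) + 3 * (av2 * ((Real.sqrt 2 * (5 * π)) * xp₁)) + κ₃F * (5 * π) ^ 3 / Λm ^ 3 * xp₀) / 64) with hAm
  set Rc := Real.sqrt (24 * (524288 * ((1 + 4 * Real.sqrt 2) ^ 2 * (2 * Real.sqrt 2 + 2) ^ 2 + 4)) * ((Λm * β / π + 1) * ((Real.sqrt 2 * ((Λm + (4 + 4 * A) * ρf ^ 2) / (2 * rm - 4 * A)) / π + 2) * (Real.sqrt 2 * (2 * ρf) / π + 2)))) with hRc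
  have hA20 : 0 ≤ Am := by rw [hAm]; positivity
  have hR₁0 : 0 ≤ (M₂ + 1) * Lr ^ 2 * Rc := by positivity
  clear_value Am Rc
  have h9 : ((9 : ℕ) : ℝ) = 9 := by norm_num
  calc 8 * ((9 : ℕ) * (D * (Real.sqrt (524288 * (1 / (1 / M₂) + 1) *
          ((1 + 2 * Real.sqrt 2 * 1 / (1 * (2 - 1)) + 2 * Real.sqrt 2 * 1 / (1 * (2 - 1))) ^ 2 *
            ((2 * Real.sqrt 2 / (1 * (2 - 1)) + 2) * (2 * Real.sqrt 2 / (1 * (2 - 1)) + 2))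
            + (1 / 1 + 1) ^ 2 / (1 + 1 * ((0 : ℕ) : ℝ)))) *
        Real.sqrt (24 * M₂ * Lr ^ 2 * ((Λm * β / π + 1) * ((Real.sqrt 2 * Lr * ((Λm + (4 + 4 * A) * ρf ^ 2) / (2 * rm - 4 * A)) / π + 2) * (Real.sqrt 2 * Lr * (2 * ρf) / π + 2)))) * AΔ)))
      ≤ 8 * ((9 : ℕ) * (D * (((M₂ + 1) * Lr ^ 2 * Rc) * (ε * (1 / (β * Lr ^ 2) * Am))))) := by
        gcongr 8 * ((9 : ℕ) * (D * ?_))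
        exact mul_le_mul hcnt hAΔ' hAΔ0 hR₁0
    _ = 8 * (9 * (D * (Rc * Am))) * ((M₂ + 1) / β) * ε := by
        rw [h9]; field_simp
    _ ≤ |8 * (9 * (D * (Rc * Am)))| * ((M₂ + 1) / β) * ε := by
        gcongr; exact le_abs_self _

end Summit.HubbardSuperconductivity.HubbardSuperconductivity.Theorems.TorusFourierL2

end
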